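import Mathlib
import Literature.NumberTheory.Transcendental.KZVolumeConjectureProofs

/-!
# `TateLifting` (stmt-KontsevichZagierPeriods-9129), line `Sketch` — stub 47: THE VOLUME FORM
# RELATIVE TO A SUBGROUP

Cresson–Viu-Sos observe [Cresson–Viu-Sos 2022, §1 p. 326] that, by Viu-Sos's semi-canonical reduction,
Kontsevich–Zagier's Conjecture 1 is equivalent to its VOLUME FORM: two compact top-dimensional
`ℚ`-semialgebraic bodies of one dimension with the same volume pass into one another by the moves of the
KZ calculus. The tree proves the absolute version over the calculus of moves
(`KZ.kzPeriodConjecture'_of_volumeConjectureCompact`, with the semi-canonical reduction discharged in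
tree, `KZ.semiCanonicalReduction_holds`). This file proves `tateLifting_volumeFormLift`, the same
equivalence RELATIVE TO AN ARBITRARY SUBGROUP `G` of the formal group with `relations ≤ G ≤ ker eval`:

  `(∀ c, eval c = 0 → c ∈ G) ↔ (two representations of one dimension with compact domains of non-empty
  interior, integrand 1 and the same value differ by an element of G)`.

* `→` is the special case: `eval ([K₁] − [K₂]) = vol K₁ − vol K₂ = 0`.
* `←`: given `c` with `eval c = 0`, write `c ≡ [r] − [r']` modulo relations
  (`KZ.exists_integralRep_sub_holds`), so that `value r = value r'` by soundness
  (`KZ.relations_le_ker_eval_holds`); then VERBATIM the tree's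
  `KZ.kzPeriodConjecture'_of_volumeConjectureCompact`: `[r] ≡ [A] − [B]`, `[r'] ≡ [A'] − [B']` with
  volume representations (`KZ.IntegralRep.exists_sub_volumeRep_mem_relations_of_semiCanonicalReduction`
  over `KZ.semiCanonicalReduction_holds`), all four raised to one dimension
  (`KZ.IntegralRep.exists_volumeRep_equivalent_of_le`) and glued, `M₁ ≡ [A] + [B']`, `M₂ ≡ [A'] + [B]`
  (`KZ.IntegralRep.exists_volumeRep_of_add_sub_of_mem_relations`); soundness gives `vol M₁ = vol M₂`, so
  the relative volume form yields `[M₁] − [M₂] ∈ G`; every other difference is a relation, hence in `G`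
  (`relations ≤ G`), and the bookkeeping is done in the formal group. The hypothesis `G ≤ ker eval` is
  not used.

References: J. Cresson, J. Viu-Sos, *On the equality of periods of Kontsevich–Zagier*, JTNB 34 (2022),
§1 p. 326; J. Viu-Sos, *A semi-canonical reduction for periods of Kontsevich–Zagier*, IJNT 17 (2021),
Thm. 1.1; M. Kontsevich, D. Zagier, *Periods* (2001), §1.2.
-/

noncomputable section

open MeasureTheory Set
open Literature.NumberTheory.Transcendental
open Literature.ModelTheory.ExponentialFields (IsSemialgebraic)

namespace Summit.KontsevichZagierPeriods.InverseLandau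

namespace VolumeFormLift

/-- **Cresson–Viu-Sos relative to a subgroup.** Let `G` be a subgroup of the formal group containing
the relations, and assume the volume form relative to `G`: two representations of one dimension with
compact domains of non-empty interior, integrand `1` and the same value differ by an element of `G`.
Then two integral representations (of any dimensions) with the same value differ by an element of `G`.
Proof: the tree's `KZ.kzPeriodConjecture'_of_volumeConjectureCompact` verbatim — `[r] ≡ [A] − [B]`,
`[r'] ≡ [A'] − [B']` with volume representations by the discharged semi-canonical reduction, raise to a
common dimension, glue `M₁ ≡ [A] + [B']`, `M₂ ≡ [A'] + [B]`, `vol M₁ = vol M₂` by soundness — the last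
step `[M₁] − [M₂] ∈ G` being the relative volume form, and the relations being lifted into `G`.
[cite: CressonViusos2022, §1 p. 326] -/
theorem of_sub_of_mem (G : AddSubgroup KZ.FormalRep) (hRG : KZ.relations ≤ G)
    (hvol : ∀ (d : ℕ) (K₁ K₂ : KZ.IntegralRep d),
      IsCompact K₁.domain → (interior K₁.domain).Nonempty →
      IsCompact K₂.domain → (interior K₂.domain).Nonempty →
      (∀ x ∈ K₁.domain, K₁.integrand x = 1) → (∀ x ∈ K₂.domain, K₂.integrand x = 1) →
      K₁.value = K₂.value → KZ.of K₁ - KZ.of K₂ ∈ G)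
    {n m : ℕ} (r : KZ.IntegralRep n) (r' : KZ.IntegralRep m) (hv : r.value = r'.value) :
    KZ.of r - KZ.of r' ∈ G := by
  obtain ⟨D, A, B, ⟨hAc, hAi, hA1⟩, ⟨hBc, hBi, hB1⟩, hrAB⟩ :=
    KZ.IntegralRep.exists_sub_volumeRep_mem_relations_of_semiCanonicalReduction
      KZ.semiCanonicalReduction_holds r
  obtain ⟨D', A', B', ⟨hA'c, hA'i, hA'1⟩, ⟨hB'c, hB'i, hB'1⟩, hr'AB⟩ :=
    KZ.IntegralRep.exists_sub_volumeRep_mem_relations_of_semiCanonicalReduction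
      KZ.semiCanonicalReduction_holds r'
  -- raise the four volume representations to the common dimension `max D D'`
  obtain ⟨A₁, hA₁c, hA₁i, hA₁1, hAA₁⟩ :=
    A.exists_volumeRep_equivalent_of_le hAc hAi hA1 (le_max_left D D')
  obtain ⟨B₁, hB₁c, hB₁i, hB₁1, hBB₁⟩ :=
    B.exists_volumeRep_equivalent_of_le hBc hBi hB1 (le_max_left D D')
  obtain ⟨A₁', hA₁'c, hA₁'i, hA₁'1, hAA₁'⟩ :=
    A'.exists_volumeRep_equivalent_of_le hA'c hA'i hA'1 (le_max_right D D')
  obtain ⟨B₁', hB₁'c, hB₁'i, hB₁'1, hBB₁'⟩ :=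
    B'.exists_volumeRep_equivalent_of_le hB'c hB'i hB'1 (le_max_right D D')
  -- glue `A₁ ⊔ B₁'` and `A₁' ⊔ B₁`
  obtain ⟨M₁, hM₁c, hM₁i, hM₁1, hM₁⟩ :=
    A₁.exists_volumeRep_of_add_sub_of_mem_relations B₁' hA₁c hA₁i hA₁1 hB₁'c hB₁'1
  obtain ⟨M₂, hM₂c, hM₂i, hM₂1, hM₂⟩ :=
    A₁'.exists_volumeRep_of_add_sub_of_mem_relations B₁ hA₁'c hA₁'i hA₁'1 hB₁c hB₁1
  -- the two glued sets have the same volume (soundness of the moves)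
  have hval : M₁.value = M₂.value := by
    have e₁ := KZ.eval_eq_zero_of_mem_relations hrAB
    have e₂ := KZ.eval_eq_zero_of_mem_relations hr'AB
    have e₃ := KZ.eval_eq_zero_of_mem_relations hM₁
    have e₄ := KZ.eval_eq_zero_of_mem_relations hM₂
    simp only [map_sub, map_add, KZ.eval_of] at e₁ e₂ e₃ e₄
    have f₁ := KZ.Equivalent.value_eq_holds hAA₁
    have f₂ := KZ.Equivalent.value_eq_holds hBB₁
    have f₃ := KZ.Equivalent.value_eq_holds hAA₁'
    have f₄ := KZ.Equivalent.value_eq_holds hBB₁'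
    linarith
  -- the relative volume form
  have hM : KZ.of M₁ - KZ.of M₂ ∈ G := hvol _ M₁ M₂ hM₁c hM₁i hM₂c hM₂i hM₁1 hM₂1 hval
  -- bookkeeping modulo relations
  have hX : KZ.of r - KZ.of r' - (KZ.of M₁ - KZ.of M₂) ∈ KZ.relations := by
    have : KZ.of r - KZ.of r' - (KZ.of M₁ - KZ.of M₂) =
        (KZ.of r - (KZ.of A - KZ.of B)) - (KZ.of r' - (KZ.of A' - KZ.of B'))
        + (KZ.of A - KZ.of A₁) - (KZ.of B - KZ.of B₁) - (KZ.of A' - KZ.of A₁')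
        + (KZ.of B' - KZ.of B₁')
        + (KZ.of A₁ + KZ.of B₁' - KZ.of M₁) - (KZ.of A₁' + KZ.of B₁ - KZ.of M₂) := by
      abel
    rw [this]
    exact KZ.relations.sub_mem (KZ.relations.add_mem (KZ.relations.add_mem
      (KZ.relations.sub_mem (KZ.relations.sub_mem (KZ.relations.add_mem
        (KZ.relations.sub_mem hrAB hr'AB) hAA₁) hBB₁) hAA₁') hBB₁') hM₁) hM₂
  -- lift the relations into `G` and add the move `[M₁] ≡ [M₂]` of `G`
  rw [← sub_add_cancel (KZ.of r - KZ.of r') (KZ.of M₁ - KZ.of M₂)]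
  exact G.add_mem (hRG hX) hM

end VolumeFormLift

/-- **The volume form relative to a subgroup** (Cresson–Viu-Sos over the tree's discharged
semi-canonical reduction `KZ.semiCanonicalReduction_holds`). For every subgroup `G` of the formal group
with `relations ≤ G ≤ ker eval`: "every formal combination of value `0` lies in `G`" iff "two
representations of one dimension with compact domains of non-empty interior, integrand `1` and the same
volume differ by an element of `G`". `→` is the special case `eval ([K₁] − [K₂]) = vol K₁ − vol K₂ = 0`;
`←`: write `c ≡ [r] − [r']` modulo relations (`KZ.exists_integralRep_sub_holds`), so that
`value r = value r'` by soundness, and conclude by `VolumeFormLift.of_sub_of_mem`.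
[cite: CressonViusos2022, §1 p. 326] -/
theorem tateLifting_volumeFormLift :
  ∀ G : AddSubgroup KZ.FormalRep, KZ.relations ≤ G → G ≤ KZ.eval.ker →
    ((∀ c : KZ.FormalRep, KZ.eval c = 0 → c ∈ G) ↔
      ∀ (d : ℕ) (K₁ K₂ : KZ.IntegralRep d),
        IsCompact K₁.domain → (interior K₁.domain).Nonempty →
        IsCompact K₂.domain → (interior K₂.domain).Nonempty →
        (∀ x ∈ K₁.domain, K₁.integrand x = 1) → (∀ x ∈ K₂.domain, K₂.integrand x = 1) →
        K₁.value = K₂.value → KZ.of K₁ - KZ.of K₂ ∈ G) := by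
  intro G hRG _
  constructor
  · intro hker d K₁ K₂ _ _ _ _ _ _ hv
    refine hker _ ?_
    rw [map_sub, KZ.eval_of, KZ.eval_of, hv, sub_self]
  · intro hvol c hc
    obtain ⟨n, m, r, r', hcr⟩ := KZ.exists_integralRep_sub_holds c
    have hv : r.value = r'.value := by
      have e := KZ.eval_eq_zero_of_mem_relations hcr
      simp only [map_sub, KZ.eval_of, hc] at e
      linarith
    rw [← sub_add_cancel c (KZ.of r - KZ.of r')]
    exact G.add_mem (hRG hcr) (VolumeFormLift.of_sub_of_mem G hRG hvol r r' hv)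

end Summit.KontsevichZagierPeriods.InverseLandau

end
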